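import Mathlib
import HarnessLib
import Summits.Ventures.LatticeQCDFlow.Scaling.ExactTransportDepth
import Summits.Ventures.LatticeQCDFlow.Scaling.AccurateTransportContraction

/-!
# LatticeQCDFlow / Scaling — depth of an ACCURATE layered flow: the contraction side (v2.6)

HONEST FRAMING: exact (Metropolis-corrected) sampling algorithms for lattice gauge theory; figures
of merit are autocorrelation/cost numbers at stated couplings and volumes; no continuum-physics
claim.

`ExactTransportDepth(R).lean` proved the LAYER-DEPTH LAW for EXACT stacks: `n` layers, each
`Λ`-Lipschitz and `Λ'`-antilipschitz for the sup metric, whose composite pushes the product Haar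
measure exactly onto the Wilson measure, need `c·β ≤ n·log(Λ·Λ')`.  That law is an exactness
artefact on its expansion side (`Λ`): it is forced by configurations of Wilson mass
`e^{-Θ(β L^d)}` which an approximate flow may ignore.  This file records what SURVIVES
approximation, as a corollary of the ε-robust contraction law
`AccurateTransportContraction` (`AccurateTransportContraction.lean`, packing proof):

* `AccurateLayerDepthLaw` (conjecture item for general compact `G`) and
  `accurateLayerDepthLaw_of_accurateTransportContraction` — if `AccurateTransportContraction d N G ρ`
  holds (a THEOREM for `U(1)`, `U(N ≥ 1)`, `SU(N ≥ 2)`, every `d ≥ 2`), then for `L ≥ L₀`, `β ≥ β₀`,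
  `ε ∈ [0, 1/4]` and every
  stack `l` of layers, each `Λ'`-antilipschitz, whose composite `compLayers l` is `ε`-ACCURATE
  (`μ_β(B) ≤ ((⊗Haar) ∘ (compLayers l)⁻¹)(B) + ε` on measurable `B`, implied by `TV ≤ ε`):
  `c·log β − C ≤ n·log Λ'` with `n = l.length` — the SAME `c`, `C` as for a single map
  (`c = 1/(16d)` in the instances).  No Lipschitz (expansion) hypothesis at all.
* `no_accurate_stack_of_coLipschitz_le_one` — in particular NO stack of NON-CONTRACTING layers
  (`Λ' ≤ 1`: isometries, gauge transformations, link-wise translations, pure expansions), of ANY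
  depth, is `1/4`-accurate at `β > exp(C/c)`, at any volume `L ≥ L₀`.
* Instances `U1.accurateLayerDepthLaw`, `UN.accurateLayerDepthLaw`, `SUN.accurateLayerDepthLaw`,
  `U1.no_accurate_stack_of_coLipschitz_le_one`.

Reading (THEORY-2.md §6 item 12): per-layer clamps `(Λ, Λ')` of an architecture obey
`n·log Λ ≥ c₁β − C₁` only if the flow is exact, but `n·log Λ' ≥ (1/16d)·log β − C` at every useful
accuracy; the second is the necessary condition that applies to trained (approximate) flows used as
Metropolis proposals.  Nothing here prices training or the KL of a given architecture.

References: THEORY-2.md §3.3 (C2a-Cε), §6 item 12; `ExactTransportDepth.lean` (exact law, [folklore]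
composition of antilipschitz constants `antilipschitzWith_compLayers`).
-/

noncomputable section

namespace Summit.Ventures.LatticeQCDFlow.Theory2.Lattice

open MeasureTheory Literature.MathematicalPhysics.QuantumFieldTheory

/-! ## §1. The ε-robust layer-depth law (contraction side) -/

section Defs

variable (d N : ℕ) (G : Type) [Group G] [MetricSpace G] [IsTopologicalGroup G] [CompactSpace G]
  [MeasurableSpace G] [BorelSpace G] (ρ : G →* Matrix (Fin N) (Fin N) ℂ)

/-- **ε-robust layer-depth law (contraction side).**  There are `c > 0`, `C`, `β₀`, `L₀` such that
for every volume `L ≥ L₀`, coupling `β ≥ β₀` and accuracy `0 ≤ ε ≤ 1/4`: if a stack `l` of layers,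
each `Λ'`-antilipschitz for the sup metric, has an `ε`-ACCURATE composite — `μ_β(B) ≤
((⊗Haar) ∘ (compLayers l)⁻¹)(B) + ε` on measurable `B` — then `c·log β − C ≤ l.length · log Λ'`.
A conjecture item for general compact `G` exactly where `AccurateTransportContraction` is one; a
THEOREM for `U(1)`, `U(N ≥ 1)`, `SU(N ≥ 2)`, every `d ≥ 2` (§2). -/
@[conjecture]
def AccurateLayerDepthLaw : Prop :=
  ∃ c : ℝ, 0 < c ∧ ∃ C β₀ : ℝ, ∃ L₀ : ℕ, ∀ (L : ℕ) [NeZero L], L₀ ≤ L → ∀ β : ℝ, β₀ ≤ β →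
    ∀ ε : ℝ, 0 ≤ ε → ε ≤ 1 / 4 →
    ∀ (l : List (GaugeConfig d L G → GaugeConfig d L G)) (Λ' : NNReal),
      (∀ T ∈ l, AntilipschitzWith Λ' T) →
      (∀ B : Set (GaugeConfig d L G), MeasurableSet B →
        wilsonMeasure (d := d) (L := L) ρ β B ≤
          (Measure.pi fun _ : Edge d L => haarProbability G).map (compLayers l) B +
            ENNReal.ofReal ε) →
      c * Real.log β - C ≤ (l.length : ℝ) * Real.log (Λ' : ℝ)

end Defs

section Law

variable {N : ℕ} {G : Type} [Group G] [MetricSpace G] [IsTopologicalGroup G] [CompactSpace G]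
  [MeasurableSpace G] [BorelSpace G] {ρ : G →* Matrix (Fin N) (Fin N) ℂ}

/-- **`AccurateTransportContraction ⟹ AccurateLayerDepthLaw`**, with the SAME constants
`c, C, β₀, L₀`.  Proof: the composite of `l` is `Λ'^{l.length}`-antilipschitz
(`antilipschitzWith_compLayers`); apply the single-map law and take logarithms. [folklore] -/
theorem accurateLayerDepthLaw_of_accurateTransportContraction {d : ℕ}
    (h : AccurateTransportContraction d N G ρ) : AccurateLayerDepthLaw d N G ρ := by
  obtain ⟨c, hc, C, β₀, L₀, hL⟩ := h
  refine ⟨c, hc, C, β₀, L₀, fun L _ hLL β hβ ε hε0 hε l Λ' hl hacc => ?_⟩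
  have hcomp : AntilipschitzWith (Λ' ^ l.length) (compLayers l) :=
    antilipschitzWith_compLayers l hl
  have := hL L hLL β hβ ε hε0 hε (compLayers l) (Λ' ^ l.length) hcomp hacc
  rwa [NNReal.coe_pow, Real.log_pow] at this

/-- **No accurate stack of non-contracting layers.**  Under `AccurateLayerDepthLaw d N G ρ`
there are `β₁` and `L₀` such that for `L ≥ L₀` and `β > β₁` NO stack of layers that are each
`Λ'`-antilipschitz with `Λ' ≤ 1` (non-contracting: `dist x y ≤ dist (T x) (T y)`) — of any depth —
is `1/4`-accurate for the Wilson measure from the product Haar measure. -/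
theorem no_accurate_stack_of_coLipschitz_le_one {d : ℕ} (h : AccurateLayerDepthLaw d N G ρ) :
    ∃ β₁ : ℝ, ∃ L₀ : ℕ, ∀ (L : ℕ) [NeZero L], L₀ ≤ L → ∀ β : ℝ, β₁ < β →
      ∀ (l : List (GaugeConfig d L G → GaugeConfig d L G)) (Λ' : NNReal), Λ' ≤ 1 →
        (∀ T ∈ l, AntilipschitzWith Λ' T) →
        ¬ (∀ B : Set (GaugeConfig d L G), MeasurableSet B →
          wilsonMeasure (d := d) (L := L) ρ β B ≤
            (Measure.pi fun _ : Edge d L => haarProbability G).map (compLayers l) B +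
              ENNReal.ofReal (1 / 4)) := by
  obtain ⟨c, hc, C, β₀, L₀, hL⟩ := h
  -- `β₁ := max β₀ (exp (C / c))`: beyond it `c·log β − C > 0 ≥ n·log Λ'`.
  refine ⟨max β₀ (Real.exp (C / c)), L₀, fun L _ hLL β hβ l Λ' hΛ hl hacc => ?_⟩
  have hβ₀ : β₀ ≤ β := le_trans (le_max_left _ _) hβ.le
  have hexp : Real.exp (C / c) < β := lt_of_le_of_lt (le_max_right _ _) hβ
  have hβpos : 0 < β := lt_trans (Real.exp_pos _) hexp
  have hlog : C / c < Real.log β := by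
    rwa [Real.lt_log_iff_exp_lt hβpos]
  have hmain := hL L hLL β hβ₀ (1 / 4) (by norm_num) le_rfl l Λ' hl hacc
  have hlogΛ : Real.log (Λ' : ℝ) ≤ 0 := Real.log_nonpos Λ'.coe_nonneg (by exact_mod_cast hΛ)
  have hrhs : (l.length : ℝ) * Real.log (Λ' : ℝ) ≤ 0 :=
    mul_nonpos_of_nonneg_of_nonpos (Nat.cast_nonneg _) hlogΛ
  have hClt : C < c * Real.log β := by
    have := (div_lt_iff₀ hc).mp hlog
    linarith [this]
  linarith

end Law

/-! ## §2. Instances: `U(1)`, `U(N)`, `SU(N)`, every `d ≥ 2` -/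

section Instances

open scoped Matrix.Norms.Frobenius
open Literature.MathematicalPhysics.QuantumFieldTheory.UnitaryCayley (𝔾)
open Literature.MathematicalPhysics.QuantumLattice (u1Rep unitaryFundamentalRep fundamentalRep)

/-- `U(1)`, `d ≥ 2`: the ε-robust layer-depth law (contraction side), `c = 1/(16d)`, `L₀ = 4`. -/
theorem U1.accurateLayerDepthLaw (d : ℕ) (hd : 2 ≤ d) : AccurateLayerDepthLaw d 1 Circle u1Rep :=
  accurateLayerDepthLaw_of_accurateTransportContraction (U1.accurateTransportContraction d hd)

/-- `U(N)`, `N ≥ 1`, `d ≥ 2` (Cayley–Frobenius metric model `𝔾 N`): the ε-robust layer-depth law. -/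
theorem UN.accurateLayerDepthLaw (d N : ℕ) (hd : 2 ≤ d) (hN : 1 ≤ N) :
    @AccurateLayerDepthLaw d N (𝔾 N) _ Subtype.metricSpace UN.isTopologicalGroup_hs UN.compactSpace_hs _
      UN.borelSpace_hs (unitaryFundamentalRep (Fin N) ℂ) :=
  @accurateLayerDepthLaw_of_accurateTransportContraction N (𝔾 N) _ Subtype.metricSpace
    UN.isTopologicalGroup_hs UN.compactSpace_hs _ UN.borelSpace_hs (unitaryFundamentalRep (Fin N) ℂ) d
    (UN.accurateTransportContraction d N hd hN)

/-- `SU(N)`, `N ≥ 2`, `d ≥ 2` (Frobenius subtype metric): the ε-robust layer-depth law. -/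
theorem SUN.accurateLayerDepthLaw (d N : ℕ) (hd : 2 ≤ d) (hN : 2 ≤ N) :
    @AccurateLayerDepthLaw d N (Matrix.specialUnitaryGroup (Fin N) ℂ) _ Subtype.metricSpace
      SUN.isTopologicalGroup_hs SUN.compactSpace_hs _ SUN.borelSpace_hs (fundamentalRep (Fin N)) :=
  @accurateLayerDepthLaw_of_accurateTransportContraction N (Matrix.specialUnitaryGroup (Fin N) ℂ) _
    Subtype.metricSpace SUN.isTopologicalGroup_hs SUN.compactSpace_hs _ SUN.borelSpace_hs
    (fundamentalRep (Fin N)) d (SUN.accurateTransportContraction d N hd hN)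

/-- `U(1)`, `d ≥ 2`: no stack of non-contracting layers, of any depth, is `1/4`-accurate at large
`β`, at any volume `L ≥ L₀`. -/
theorem U1.no_accurate_stack_of_coLipschitz_le_one (d : ℕ) (hd : 2 ≤ d) :
    ∃ β₁ : ℝ, ∃ L₀ : ℕ, ∀ (L : ℕ) [NeZero L], L₀ ≤ L → ∀ β : ℝ, β₁ < β →
      ∀ (l : List (GaugeConfig d L Circle → GaugeConfig d L Circle)) (Λ' : NNReal), Λ' ≤ 1 →
        (∀ T ∈ l, AntilipschitzWith Λ' T) →
        ¬ (∀ B : Set (GaugeConfig d L Circle), MeasurableSet B →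
          wilsonMeasure (d := d) (L := L) u1Rep β B ≤
            (Measure.pi fun _ : Edge d L => haarProbability Circle).map (compLayers l) B +
              ENNReal.ofReal (1 / 4)) :=
  Lattice.no_accurate_stack_of_coLipschitz_le_one (U1.accurateLayerDepthLaw d hd)

end Instances

end Summit.Ventures.LatticeQCDFlow.Theory2.Lattice

end
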